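import Literature.MathematicalPhysics.QuantumFieldTheory.Balaban1983to89.B7Transfer
import Literature.MathematicalPhysics.QuantumFieldTheory.Balaban1983to89.MatrixLog

/-!
# `Balaban1983to89.B7TransferLog` — the group step (161) ⇒ (162) of B7 in its printed LOGARITHMIC form

CITATION HEADER (lean-in-tree rule 2026-08-18).  Kernel arithmetic for one displayed step of
T. Bałaban, *Averaging operations for lattice gauge theories*, Comm. Math. Phys. **98**, 17–51 (1985)
[Balaban1985Averaging] (cell paper B7 of the audit cell `pub-balaban`; `paper:balaban1985-cmp98-averaging`,
journal page = PDF page + 16), Sect. E p. 42 [PDF 26], read from the page render `…1985-cmp98-averaging-p026-x2.png`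
(and Sect. A p. 22 [PDF 6], render `…-p006-x2.png`, for (26)); both re-read by the filing unit on 2026-08-18.
PRINTED (p. 42): "From Proposition 4, and especially from (131), we get `|(1/i) log U̿′^j| = |Q_j(U₀, ηA′)| < 2α₁L^jη`, (161)
hence `|(1/i) log(\overline{R̄^j_{0,x}U̿′^j})| = |Σ_{x_j∈B(x)} L^{-d} (1/i) log(R̄^j_{0,x}U̿′^j)(Γ_{x,x_j})| < 8α₁dL^{j+1}η e^{2α₁dL^{j+1}η}
< O(1)α₁L^{j+1}η, j = 0, 1, …, k−1 (162)".  PRINTED (p. 22): "For matrices `X` satisfying `|X − 1| ≤ ½`, we have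
`|log X| ≤ Σ_{n=1}^∞ (1/n)|X − 1|^n ≤ |X − 1|/(1 − |X − 1|) ≤ 2|X − 1|`, (26)".
The paper is a manuscript UNDER ADJUDICATION by the cell; nothing of it is asserted here.  Every hypothesis below is
an explicit binder and the file proves only normed-algebra inequalities.

WHAT THE TREE ALREADY HAS.  `B7Transfer.ineq162_of_161` (unit b07-g2) certifies the chain behind (162) up to the
logarithm: for a path product of `s ≤ d(L−1)` factors `W_i exp(B_i) W′_i` (`W_iW′_i = 1`, norms `≤ 1`,
`‖B_i‖ ≤ 2α₁ℓ`, `ℓ = L^jη` — the READING of the symbol `(R̄^j_{0,x}U̿′^j)(Γ_{x,x_j})` via (77) p. 30 and (159)–(160)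
p. 42, stated in the header of `B7Transfer` §2) one has `‖∏ − 1‖ ≤ e^{s·2α₁ℓ} − 1` and
`2(e^{s·2α₁ℓ} − 1) ≤ 8α₁d(Lℓ)e^{2α₁d(Lℓ)}`, plus the domain statement `2dα₁(Lℓ) ≤ 1/3 ⇒ ‖∏ − 1‖ ≤ ½`; its header
records as "NOT certified (no Banach-algebra logarithm in Mathlib): the inequality (26) itself and the identity
`exp((1/i)·log X· i) = X`".  `MatrixLog` (unit f1-g4) has since supplied the logarithm (21) `mlog` with (26)
`norm_mlog_le_two_mul` and `exp_mlog`.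

WHAT THIS FILE ADDS (kernel-checked, no new hypotheses on the paper).  `ineq162_log_of_161`: the printed left member
of one summand of (162), `‖(1/i) log ∏‖ ≤ 8α₁d(Lℓ)e^{2α₁d(Lℓ)}` together with `exp(log ∏) = ∏`, under the hypotheses of
`ineq162_of_161` and the (26)-domain condition `2dα₁(Lℓ) ≤ 1/3` (this corollary was prepared and farm-checked by unit
f1-g4, `pub-balaban/b2b-balaban-f1/g4/B7Transfer-log162-snippet.lean`, and is landed here unchanged in substance);
`ineq162_blockAvg_of_161`: the printed MIDDLE member of (162) — the `L^{-d}`-weighted average over `x_j ∈ B(x)` of the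
path logarithms, typed as an arbitrary convex combination (weights `≥ 0` summing to `1`; in print `L^{-d}` over the
`L^d` sites of `B(x)`) — obeys the same bound (`B7Transfer.convex_comb_norm_le`).  Print has strict `<`; the typed
conclusions are `≤` under the non-strict hypothesis `‖B_i‖ ≤ 2α₁ℓ` (print ⇒ typed).  NOT typed here: the first
equality of (162), `(1/i) log(\overline{R̄^j_{0,x}U̿′^j}) = Σ_{x_j} L^{-d}(1/i) log(…)(Γ_{x,x_j})`, which is the
definition (78)/(85) of the block average of site variables (an `exp` of `i`× that average) followed by `log ∘ exp = id`
on small elements; it needs the carrier of (78), which the tree does not have.  Unit `b2b-balaban-pv14` (surge node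
prover #14; cross-reader of B7, GAPS C-pv14-1, C-pv14-2, C-pv14-6).
-/

noncomputable section

open NormedSpace

namespace Literature.MathematicalPhysics.QuantumFieldTheory.Balaban1983to89.B7TransferLog

open B7Prop6Bound B7Transfer MatrixLog Finset

variable {𝔸 : Type*} [NormedRing 𝔸] [NormedAlgebra ℂ 𝔸] [CompleteSpace 𝔸]

/-- (161) ⇒ (162) for ONE path, in the printed logarithmic form: under the hypotheses of
`B7Transfer.ineq162_of_161` (`s ≤ d(L−1)` factors `W_i exp(B_i) W′_i`, `W_iW′_i = 1`, `‖W_i‖, ‖W′_i‖ ≤ 1`,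
`‖B_i‖ ≤ 2α₁ℓ`) and the domain condition `2dα₁(Lℓ) ≤ 1/3` of (26), the logarithm (21) of the path product satisfies
`‖(1/i) log ∏‖ = ‖log ∏‖ ≤ 2‖∏ − 1‖ ≤ 8α₁d(Lℓ)e^{2α₁d(Lℓ)}` ((26) = `MatrixLog.norm_mlog_le_two_mul`, then
`ineq162_of_161`) and `exp(log ∏) = ∏` (`MatrixLog.exp_mlog`).  Corollary prepared by unit f1-g4.
[cite: Balaban1985Averaging, (161)–(162) p.42 with (21), (26) pp.21–22] -/
theorem ineq162_log_of_161 (W B W' : ℕ → 𝔸) (s : ℕ) {d L α₁ ℓ : ℝ}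
    (hs : (s : ℝ) ≤ d * (L - 1)) (hd : 0 ≤ d) (hα : 0 ≤ α₁) (hℓ : 0 ≤ ℓ)
    (hWW' : ∀ i < s, W i * W' i = 1) (hW : ∀ i < s, ‖W i‖ ≤ 1) (hW' : ∀ i < s, ‖W' i‖ ≤ 1)
    (hB : ∀ i < s, ‖B i‖ ≤ 2 * α₁ * ℓ) (hsmall : 2 * d * α₁ * (L * ℓ) ≤ 1 / 3) :
    ‖(Complex.I⁻¹ : ℂ) • mlog (oprod (fun i => W i * exp (B i) * W' i) s)‖
        ≤ 8 * α₁ * d * (L * ℓ) * Real.exp (2 * α₁ * d * (L * ℓ)) ∧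
    exp (mlog (oprod (fun i => W i * exp (B i) * W' i) s)) = oprod (fun i => W i * exp (B i) * W' i) s := by
  obtain ⟨h1, h2, h3⟩ := ineq162_of_161 W B W' s hs hd hα hℓ hWW' hW hW' hB
  have hhalf : ‖oprod (fun i => W i * exp (B i) * W' i) s - 1‖ ≤ 1 / 2 := h3 hsmall
  refine ⟨?_, exp_mlog (by linarith)⟩
  rw [norm_smul, norm_inv, Complex.norm_I, inv_one, one_mul]
  calc ‖mlog (oprod (fun i => W i * exp (B i) * W' i) s)‖
      ≤ 2 * ‖oprod (fun i => W i * exp (B i) * W' i) s - 1‖ := norm_mlog_le_two_mul hhalf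
    _ ≤ 2 * (Real.exp (s * (2 * α₁ * ℓ)) - 1) := by linarith
    _ ≤ 8 * α₁ * d * (L * ℓ) * Real.exp (2 * α₁ * d * (L * ℓ)) := h2

/-- (161) ⇒ (162), the printed MIDDLE member: the block average
`Σ_{x_j∈B(x)} L^{-d} (1/i) log(R̄^j_{0,x}U̿′^j)(Γ_{x,x_j})`, typed as a convex combination (index set `t` = the sites
`x_j` of `B(x)`, weights `wt ≥ 0` with `Σ wt = 1`; in print `wt = L^{-d}`, `|B(x)| = L^d`) of the path logarithms of
`ineq162_log_of_161` (one path per site, each with `s(x_j) ≤ d(L−1)` factors), has norm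
`≤ 8α₁d(Lℓ)e^{2α₁d(Lℓ)}` — a convex combination does not increase a uniform bound (`B7Transfer.convex_comb_norm_le`).
[cite: Balaban1985Averaging, (162) p.42] -/
theorem ineq162_blockAvg_of_161 {ι : Type*} (t : Finset ι) (wt : ι → ℝ)
    (hw : ∀ x ∈ t, 0 ≤ wt x) (hsum : ∑ x ∈ t, wt x = 1)
    (W B W' : ι → ℕ → 𝔸) (s : ι → ℕ) {d L α₁ ℓ : ℝ}
    (hs : ∀ x ∈ t, (s x : ℝ) ≤ d * (L - 1)) (hd : 0 ≤ d) (hα : 0 ≤ α₁) (hℓ : 0 ≤ ℓ)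
    (hWW' : ∀ x ∈ t, ∀ i < s x, W x i * W' x i = 1) (hW : ∀ x ∈ t, ∀ i < s x, ‖W x i‖ ≤ 1)
    (hW' : ∀ x ∈ t, ∀ i < s x, ‖W' x i‖ ≤ 1) (hB : ∀ x ∈ t, ∀ i < s x, ‖B x i‖ ≤ 2 * α₁ * ℓ)
    (hsmall : 2 * d * α₁ * (L * ℓ) ≤ 1 / 3) :
    ‖∑ x ∈ t, wt x • ((Complex.I⁻¹ : ℂ) • mlog (oprod (fun i => W x i * exp (B x i) * W' x i) (s x)))‖
      ≤ 8 * α₁ * d * (L * ℓ) * Real.exp (2 * α₁ * d * (L * ℓ)) :=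
  convex_comb_norm_le t wt _ hw hsum fun x hx =>
    (ineq162_log_of_161 (W x) (B x) (W' x) (s x) (hs x hx) hd hα hℓ (hWW' x hx) (hW x hx) (hW' x hx)
      (hB x hx) hsmall).1

end Literature.MathematicalPhysics.QuantumFieldTheory.Balaban1983to89.B7TransferLog
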